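import Literature.Combinatorics.Additive.TPPGroupAlgebra
import Summits.MatrixMultiplication.OmegaCensus.DihedralLikeVertexCounting
import HarnessLib

/-!
# Real-character parity of law-attaining cube triples in dihedral-like groups

ω-census, family (b3).  Framing: lottery ticket; floor = certified bounds/negative ranges.

Setting of `DihedralLikeVertexCounting.lean`: a dihedral-like presentation `ρ, τ : A → G` over a finite abelian group
`A` (any `c₀`), a TPP triple `(S, T, U)` with coset parts `X₀ = {a : ρ a ∈ X}`, `X₁ = {a : τ a ∈ X}` and part sizes
`s₀ = s₁ = c`, `t₀ = t₁ = d`, `u₀ = u₁ = e` (a *cube shape*) attaining the law `3|S||T||U| + 8 = 8|A|`, i.e.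
`|A| = 3cde + 1`.  At every vertex of the cube `{0,1}³` the three adjacent boxes are then pairwise disjoint of total size
`|A| − 1` (a near-tiling); the six vertices other than `000`, `111` are the vertices `000`, `111` of the right
translates `(S·τ0, T, U)`, `(S, T·τ0, U)`, `(S, T, U·τ0)`, whose coset parts are `(−c₀ − X₁, −X₀)` in the translated
coordinate.

**Theorem (`parts_sgnSum_of_law_cube`).** Let `χ : A → {1, −1} ⊂ ℤ` be multiplicative (`χ(a+b) = χ(a)χ(b)`) with
`∑_{a ∈ A} χ(a) = 0` — i.e. `χ = (−1)^φ` for a non-trivial homomorphism `φ : A →+ ZMod 2` — and `χ(X) = ∑_{a ∈ X} χ(a)`.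
Then `χ(S₀), χ(S₁), χ(T₀), χ(T₁), χ(U₀), χ(U₁) ∈ {1, −1}`.
*Proof.* Applying `χ` to the eight near-tilings gives, with `σᵢ = χ(Sᵢ)`, `πⱼ = χ(Tⱼ)`, `ξₖ = χ(Uₖ)`, `γ = χ(c₀)` and
box products `B_{ijk} = σᵢπⱼξₖ ∈ ℤ`: the three vertex-`000` sums of the translated triples add up to
`3B₀₀₀ + 2γ(B₀₁₁ + B₁₀₁ + B₁₁₀) = 3B₀₀₀ ± 2`, each being `±1`; hence `3B₀₀₀` is odd with `|3B₀₀₀| ≤ 5`, so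
`B₀₀₀ = ±1` and all of `σ₀, π₀, ξ₀` are `±1`; symmetrically `3γB₁₁₁ ± 2 ∈ {−3, …, 3}` gives `B₁₁₁ = ±1`.
Such `χ` exist exactly when `|A|` is even (then `c, d, e` are odd).  Consequences (`CubeLawParityRank.lean`): a part of
size `3` forces `dim A/2A ≤ 2`, which excludes e.g. six of the eleven abelian groups of order `64` from the open cube
shape `(1,3,7)` of the `|A| ≡ 1 (mod 3)` law classification, and `ℤ₂³ × ℤ₁₇`, `ℤ₂³ × ℤ₃₅` at `|A| = 136, 280`.
-/

namespace Summit.MatrixMultiplication.OmegaCensus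

open Literature.Combinatorics.Additive Finset

/-! ## Real characters `χ : A → {±1}` -/

section Sign

variable {A : Type*} [AddCommGroup A] [Fintype A] [DecidableEq A] {χ : A → ℤ}

omit [Fintype A] [DecidableEq A] in
/-- A multiplicative `±1`-valued function has `χ(0) = 1`. [folklore] -/
theorem realChar_zero (hmul : ∀ a b, χ (a + b) = χ a * χ b) (hval : ∀ a, χ a = 1 ∨ χ a = -1) : χ 0 = 1 := by
  have h := hmul 0 0
  rw [add_zero] at h
  rcases hval 0 with h0 | h0
  · exact h0
  · rw [h0] at h; norm_num at h

omit [Fintype A] [DecidableEq A] in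
/-- `χ(−a) = χ(a)` for a real character. [folklore] -/
theorem realChar_neg (hmul : ∀ a b, χ (a + b) = χ a * χ b) (hval : ∀ a, χ a = 1 ∨ χ a = -1) (a : A) :
    χ (-a) = χ a := by
  have h := hmul a (-a)
  rw [add_neg_cancel, realChar_zero hmul hval] at h
  rcases hval a with ha | ha <;> rw [ha] at h ⊢ <;> linarith

omit [Fintype A] in
/-- The `χ`-sum of an injective triple sumset factorises. [folklore] -/
theorem realChar_sumset (hmul : ∀ a b, χ (a + b) = χ a * χ b) {X Y Z : Finset A}
    (hinj : Set.InjOn (fun p : A × A × A => p.1 + p.2.1 + p.2.2) ↑(X ×ˢ Y ×ˢ Z)) :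
    ∑ x ∈ (X ×ˢ Y ×ˢ Z).image (fun p : A × A × A => p.1 + p.2.1 + p.2.2), χ x =
      (∑ a ∈ X, χ a) * (∑ b ∈ Y, χ b) * (∑ c ∈ Z, χ c) := by
  rw [Finset.sum_image hinj, Finset.sum_product_right, Finset.sum_product_right]
  simp only [hmul, Finset.sum_mul, Finset.mul_sum]

omit [AddCommGroup A] in
/-- Three pairwise disjoint sets of total size `|A| − 1`: for a `±1`-valued function summing to `0` over `A` their
`χ`-sums add up to `±1` (minus the value at the missed point). [folklore] -/
theorem realChar_near_tiling (hval : ∀ a, χ a = 1 ∨ χ a = -1) (hsum : ∑ a, χ a = 0) {P Q R : Finset A}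
    (hPQ : Disjoint P Q) (hPR : Disjoint P R) (hQR : Disjoint Q R)
    (hcard : P.card + Q.card + R.card + 1 = Fintype.card A) :
    (∑ x ∈ P, χ x) + (∑ x ∈ Q, χ x) + (∑ x ∈ R, χ x) = 1 ∨
      (∑ x ∈ P, χ x) + (∑ x ∈ Q, χ x) + (∑ x ∈ R, χ x) = -1 := by
  set W := P ∪ Q ∪ R with hW
  have cW : W.card = P.card + Q.card + R.card := by
    rw [hW, card_union_of_disjoint (disjoint_union_left.2 ⟨hPR, hQR⟩), card_union_of_disjoint hPQ]
  have hC : (univ \ W).card = 1 := by rw [card_univ_sdiff, cW]; omega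
  obtain ⟨x, hx⟩ := card_eq_one.1 hC
  have hsplit : ∑ a, χ a = (∑ a ∈ W, χ a) + ∑ a ∈ univ \ W, χ a := by
    rw [← sum_union disjoint_sdiff, union_sdiff_of_subset (subset_univ W)]
  rw [hsum, hx, sum_singleton, hW, sum_union (disjoint_union_left.2 ⟨hPR, hQR⟩), sum_union hPQ] at hsplit
  rcases hval x with h | h <;> rw [h] at hsplit
  · right; linarith
  · left; linarith

omit [Fintype A] in
/-- `χ`-sum of a negated set. [folklore] -/
theorem realChar_image_neg (hmul : ∀ a b, χ (a + b) = χ a * χ b) (hval : ∀ a, χ a = 1 ∨ χ a = -1)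
    (X : Finset A) : ∑ a ∈ X.image (fun b => -b), χ a = ∑ a ∈ X, χ a := by
  rw [sum_image fun _ _ _ _ h => neg_injective h]
  exact sum_congr rfl fun a _ => realChar_neg hmul hval a

omit [Fintype A] in
/-- `χ`-sum of the set `−c − X` is `χ(c) χ(X)`. [folklore] -/
theorem realChar_image_neg_sub (hmul : ∀ a b, χ (a + b) = χ a * χ b) (hval : ∀ a, χ a = 1 ∨ χ a = -1)
    (X : Finset A) (c : A) : ∑ a ∈ X.image (fun b => -c - b), χ a = χ c * ∑ a ∈ X, χ a := by
  rw [sum_image fun _ _ _ _ h => sub_right_injective h, mul_sum]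
  refine sum_congr rfl fun a _ => ?_
  show χ (-c - a) = _
  rw [show -c - a = -(c + a) by abel, realChar_neg hmul hval, hmul]

omit [Fintype A] [DecidableEq A] in
/-- If a product of three integers is `±1` then each factor is `±1`. [folklore] -/
theorem pm_one_of_mul₃ {x y z : ℤ} (h : x * y * z = 1 ∨ x * y * z = -1) :
    (x = 1 ∨ x = -1) ∧ (y = 1 ∨ y = -1) ∧ (z = 1 ∨ z = -1) := by
  have habs : (x * y * z).natAbs = 1 := by rcases h with h | h <;> rw [h] <;> rfl
  rw [Int.natAbs_mul, Int.natAbs_mul] at habs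
  have hz : z.natAbs = 1 := Nat.eq_one_of_mul_eq_one_left habs
  have hxy : x.natAbs * y.natAbs = 1 := Nat.eq_one_of_mul_eq_one_right habs
  have hx : x.natAbs = 1 := Nat.eq_one_of_mul_eq_one_right hxy
  have hy : y.natAbs = 1 := Nat.eq_one_of_mul_eq_one_left hxy
  exact ⟨Int.natAbs_eq_natAbs_iff.1 (hx.trans (by rfl : (1 : ℤ).natAbs = 1).symm) |>.imp id id,
    Int.natAbs_eq_natAbs_iff.1 (hy.trans (by rfl : (1 : ℤ).natAbs = 1).symm) |>.imp id id,
    Int.natAbs_eq_natAbs_iff.1 (hz.trans (by rfl : (1 : ℤ).natAbs = 1).symm) |>.imp id id⟩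

omit [Fintype A] [DecidableEq A] in
/-- Arithmetic core: `3B + 2γε = ε₁ + ε₂ + ε₃` with `γ, ε, εᵢ ∈ {±1}` forces `B = ±1`. [folklore] -/
theorem pm_one_of_three_mul {B γ ε ε₁ ε₂ ε₃ : ℤ} (hγ : γ = 1 ∨ γ = -1) (hε : ε = 1 ∨ ε = -1)
    (h₁ : ε₁ = 1 ∨ ε₁ = -1) (h₂ : ε₂ = 1 ∨ ε₂ = -1) (h₃ : ε₃ = 1 ∨ ε₃ = -1)
    (h : 3 * B + 2 * γ * ε = ε₁ + ε₂ + ε₃) : B = 1 ∨ B = -1 := by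
  rcases hγ with rfl | rfl <;> rcases hε with rfl | rfl <;> omega

end Sign

/-! ## Vertex character sums of a TPP triple in a dihedral-like group -/

section DihedralLike

variable {A : Type*} [AddCommGroup A] [DecidableEq A] [Fintype A] {G : Type} [Group G] [DecidableEq G]
  {ρ τ : A → G} {c₀ : A} {S T U : Finset G} {χ : A → ℤ}


/-- **Vertex `000`.** If the three boxes `S₁+T₀+U₀`, `S₀+T₁+U₀`, `S₀+T₀+U₁` of a TPP triple have total size
`|A| − 1`, then `σ₁π₀ξ₀ + σ₀π₁ξ₀ + σ₀π₀ξ₁ = ±1` for the `χ`-sums of the parts. [folklore] -/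
theorem vertex000_sgnSum (hρρ : ∀ a b, ρ a * ρ b = ρ (a + b)) (hρτ : ∀ a b, ρ a * τ b = τ (b - a))
    (hτρ : ∀ a b, τ a * ρ b = τ (a + b)) (hττ : ∀ a b, τ a * τ b = ρ (c₀ + b - a))
    (hρ : Function.Injective ρ) (hτ : Function.Injective τ) (hne : ∀ a b, ρ a ≠ τ b)
    (h : TripleProductProperty S T U) (hmul : ∀ a b, χ (a + b) = χ a * χ b) (hval : ∀ a, χ a = 1 ∨ χ a = -1) (hsum : ∑ a, χ a = 0)
    (h000 : (univ.filter fun a : A => τ a ∈ S).card * (univ.filter fun a : A => ρ a ∈ T).card *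
        (univ.filter fun a : A => ρ a ∈ U).card +
      (univ.filter fun a : A => ρ a ∈ S).card * (univ.filter fun a : A => τ a ∈ T).card *
        (univ.filter fun a : A => ρ a ∈ U).card +
      (univ.filter fun a : A => ρ a ∈ S).card * (univ.filter fun a : A => ρ a ∈ T).card *
        (univ.filter fun a : A => τ a ∈ U).card + 1 = Fintype.card A) :
    (∑ a ∈ univ.filter (fun a : A => τ a ∈ S), χ a) * (∑ a ∈ univ.filter (fun a : A => ρ a ∈ T), χ a) * (∑ a ∈ univ.filter (fun a : A => ρ a ∈ U), χ a) + (∑ a ∈ univ.filter (fun a : A => ρ a ∈ S), χ a) * (∑ a ∈ univ.filter (fun a : A => τ a ∈ T), χ a) * (∑ a ∈ univ.filter (fun a : A => ρ a ∈ U), χ a) +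
        (∑ a ∈ univ.filter (fun a : A => ρ a ∈ S), χ a) * (∑ a ∈ univ.filter (fun a : A => ρ a ∈ T), χ a) * (∑ a ∈ univ.filter (fun a : A => τ a ∈ U), χ a) = 1 ∨
      (∑ a ∈ univ.filter (fun a : A => τ a ∈ S), χ a) * (∑ a ∈ univ.filter (fun a : A => ρ a ∈ T), χ a) * (∑ a ∈ univ.filter (fun a : A => ρ a ∈ U), χ a) + (∑ a ∈ univ.filter (fun a : A => ρ a ∈ S), χ a) * (∑ a ∈ univ.filter (fun a : A => τ a ∈ T), χ a) * (∑ a ∈ univ.filter (fun a : A => ρ a ∈ U), χ a) +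
        (∑ a ∈ univ.filter (fun a : A => ρ a ∈ S), χ a) * (∑ a ∈ univ.filter (fun a : A => ρ a ∈ T), χ a) * (∑ a ∈ univ.filter (fun a : A => τ a ∈ U), χ a) = -1 := by
  set S₀ : Finset A := univ.filter fun a => ρ a ∈ S with hS₀
  set S₁ : Finset A := univ.filter fun a => τ a ∈ S with hS₁
  set T₀ : Finset A := univ.filter fun a => ρ a ∈ T with hT₀
  set T₁ : Finset A := univ.filter fun a => τ a ∈ T with hT₁
  set U₀ : Finset A := univ.filter fun a => ρ a ∈ U with hU₀
  set U₁ : Finset A := univ.filter fun a => τ a ∈ U with hU₁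
  have mS₀ : ∀ a ∈ S₀, cond false (τ a) (ρ a) ∈ S := fun a ha => by simpa [hS₀] using ha
  have mS₁ : ∀ a ∈ S₁, cond true (τ a) (ρ a) ∈ S := fun a ha => by simpa [hS₁] using ha
  have mT₀ : ∀ a ∈ T₀, cond false (τ a) (ρ a) ∈ T := fun a ha => by simpa [hT₀] using ha
  have mT₁ : ∀ a ∈ T₁, cond true (τ a) (ρ a) ∈ T := fun a ha => by simpa [hT₁] using ha
  have mU₀ : ∀ a ∈ U₀, cond false (τ a) (ρ a) ∈ U := fun a ha => by simpa [hU₀] using ha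
  have mU₁ : ∀ a ∈ U₁, cond true (τ a) (ρ a) ∈ U := fun a ha => by simpa [hU₁] using ha
  have cs := card_sumset' hρρ hττ hρ hτ h
  have inj := sum_injOn' hρρ hττ hρ hτ h
  have d₁ := disjoint_sumset₁' hρρ hρτ hτρ hττ hne h
  have d₂ := disjoint_sumset₂' hρρ hρτ hτρ hττ hne h
  have d₃ := disjoint_sumset₃' hρρ hρτ hτρ hττ hne h
  have key := realChar_near_tiling hval hsum (d₁ false mS₁ mT₀ mU₀ mS₀ mT₁) (d₃ false mS₀ mT₀ mU₁ mS₁ mU₀).symm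
    (d₂ false mS₀ mT₁ mU₀ mS₀ mT₀ mU₁)
    (by rw [cs true false false mS₁ mT₀ mU₀, cs false true false mS₀ mT₁ mU₀, cs false false true mS₀ mT₀ mU₁]
        exact h000)
  rw [realChar_sumset hmul (inj true false false mS₁ mT₀ mU₀), realChar_sumset hmul (inj false true false mS₀ mT₁ mU₀),
    realChar_sumset hmul (inj false false true mS₀ mT₀ mU₁)] at key
  exact key

/-- **Vertex `111`.** If the three boxes `S₀+T₁+U₁`, `S₁+T₀+U₁`, `S₁+T₁+U₀` of a TPP triple have total size
`|A| − 1`, then `σ₀π₁ξ₁ + σ₁π₀ξ₁ + σ₁π₁ξ₀ = ±1`. [folklore] -/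
theorem vertex111_sgnSum (hρρ : ∀ a b, ρ a * ρ b = ρ (a + b)) (hρτ : ∀ a b, ρ a * τ b = τ (b - a))
    (hτρ : ∀ a b, τ a * ρ b = τ (a + b)) (hττ : ∀ a b, τ a * τ b = ρ (c₀ + b - a))
    (hρ : Function.Injective ρ) (hτ : Function.Injective τ) (hne : ∀ a b, ρ a ≠ τ b)
    (h : TripleProductProperty S T U) (hmul : ∀ a b, χ (a + b) = χ a * χ b) (hval : ∀ a, χ a = 1 ∨ χ a = -1) (hsum : ∑ a, χ a = 0)
    (h111 : (univ.filter fun a : A => ρ a ∈ S).card * (univ.filter fun a : A => τ a ∈ T).card *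
        (univ.filter fun a : A => τ a ∈ U).card +
      (univ.filter fun a : A => τ a ∈ S).card * (univ.filter fun a : A => ρ a ∈ T).card *
        (univ.filter fun a : A => τ a ∈ U).card +
      (univ.filter fun a : A => τ a ∈ S).card * (univ.filter fun a : A => τ a ∈ T).card *
        (univ.filter fun a : A => ρ a ∈ U).card + 1 = Fintype.card A) :
    (∑ a ∈ univ.filter (fun a : A => ρ a ∈ S), χ a) * (∑ a ∈ univ.filter (fun a : A => τ a ∈ T), χ a) * (∑ a ∈ univ.filter (fun a : A => τ a ∈ U), χ a) + (∑ a ∈ univ.filter (fun a : A => τ a ∈ S), χ a) * (∑ a ∈ univ.filter (fun a : A => ρ a ∈ T), χ a) * (∑ a ∈ univ.filter (fun a : A => τ a ∈ U), χ a) +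
        (∑ a ∈ univ.filter (fun a : A => τ a ∈ S), χ a) * (∑ a ∈ univ.filter (fun a : A => τ a ∈ T), χ a) * (∑ a ∈ univ.filter (fun a : A => ρ a ∈ U), χ a) = 1 ∨
      (∑ a ∈ univ.filter (fun a : A => ρ a ∈ S), χ a) * (∑ a ∈ univ.filter (fun a : A => τ a ∈ T), χ a) * (∑ a ∈ univ.filter (fun a : A => τ a ∈ U), χ a) + (∑ a ∈ univ.filter (fun a : A => τ a ∈ S), χ a) * (∑ a ∈ univ.filter (fun a : A => ρ a ∈ T), χ a) * (∑ a ∈ univ.filter (fun a : A => τ a ∈ U), χ a) +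
        (∑ a ∈ univ.filter (fun a : A => τ a ∈ S), χ a) * (∑ a ∈ univ.filter (fun a : A => τ a ∈ T), χ a) * (∑ a ∈ univ.filter (fun a : A => ρ a ∈ U), χ a) = -1 := by
  set S₀ : Finset A := univ.filter fun a => ρ a ∈ S with hS₀
  set S₁ : Finset A := univ.filter fun a => τ a ∈ S with hS₁
  set T₀ : Finset A := univ.filter fun a => ρ a ∈ T with hT₀
  set T₁ : Finset A := univ.filter fun a => τ a ∈ T with hT₁
  set U₀ : Finset A := univ.filter fun a => ρ a ∈ U with hU₀
  set U₁ : Finset A := univ.filter fun a => τ a ∈ U with hU₁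
  have mS₀ : ∀ a ∈ S₀, cond false (τ a) (ρ a) ∈ S := fun a ha => by simpa [hS₀] using ha
  have mS₁ : ∀ a ∈ S₁, cond true (τ a) (ρ a) ∈ S := fun a ha => by simpa [hS₁] using ha
  have mT₀ : ∀ a ∈ T₀, cond false (τ a) (ρ a) ∈ T := fun a ha => by simpa [hT₀] using ha
  have mT₁ : ∀ a ∈ T₁, cond true (τ a) (ρ a) ∈ T := fun a ha => by simpa [hT₁] using ha
  have mU₀ : ∀ a ∈ U₀, cond false (τ a) (ρ a) ∈ U := fun a ha => by simpa [hU₀] using ha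
  have mU₁ : ∀ a ∈ U₁, cond true (τ a) (ρ a) ∈ U := fun a ha => by simpa [hU₁] using ha
  have cs := card_sumset' hρρ hττ hρ hτ h
  have inj := sum_injOn' hρρ hττ hρ hτ h
  have d₁ := disjoint_sumset₁' hρρ hρτ hτρ hττ hne h
  have d₂ := disjoint_sumset₂' hρρ hρτ hτρ hττ hne h
  have d₃ := disjoint_sumset₃' hρρ hρτ hτρ hττ hne h
  -- boxes `P = S₀+T₁+U₁`, `Q = S₁+T₀+U₁`, `R = S₁+T₁+U₀`
  have key := realChar_near_tiling hval hsum (d₁ true mS₁ mT₀ mU₁ mS₀ mT₁).symm (d₃ true mS₀ mT₁ mU₁ mS₁ mU₀)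
    (d₂ true mS₁ mT₁ mU₀ mS₁ mT₀ mU₁).symm
    (by rw [cs false true true mS₀ mT₁ mU₁, cs true false true mS₁ mT₀ mU₁, cs true true false mS₁ mT₁ mU₀]
        exact h111)
  rw [realChar_sumset hmul (inj false true true mS₀ mT₁ mU₁), realChar_sumset hmul (inj true false true mS₁ mT₀ mU₁),
    realChar_sumset hmul (inj true true false mS₁ mT₁ mU₀)] at key
  exact key

/-- The `ρ`-part of `X·τ0` is `−c₀ − X₁` (as a set). [folklore] -/
theorem rho_part_mulRight_tau (hρρ : ∀ a b, ρ a * ρ b = ρ (a + b)) (hρτ : ∀ a b, ρ a * τ b = τ (b - a))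
    (hττ : ∀ a b, τ a * τ b = ρ (c₀ + b - a)) (X : Finset G) :
    (univ.filter fun a : A => ρ a ∈ X.map (Equiv.mulRight (τ 0)).toEmbedding) =
      (univ.filter fun b : A => τ b ∈ X).image fun b => -c₀ - b := by
  ext a
  simp only [mem_filter, mem_univ, true_and, mem_image, Finset.mem_map_equiv, Equiv.mulRight_symm_apply]
  rw [inv_tau hρρ hττ, hρτ, zero_sub]
  constructor
  · intro h
    exact ⟨-c₀ - a, h, by abel⟩
  · rintro ⟨b, hb, rfl⟩
    have e : -c₀ - (-c₀ - b) = b := by abel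
    rwa [e]

/-- The `τ`-part of `X·τ0` is `−X₀` (as a set). [folklore] -/
theorem tau_part_mulRight_tau (hρρ : ∀ a b, ρ a * ρ b = ρ (a + b))
    (hττ : ∀ a b, τ a * τ b = ρ (c₀ + b - a)) (X : Finset G) :
    (univ.filter fun a : A => τ a ∈ X.map (Equiv.mulRight (τ 0)).toEmbedding) =
      (univ.filter fun b : A => ρ b ∈ X).image fun b => -b := by
  ext a
  simp only [mem_filter, mem_univ, true_and, mem_image, Finset.mem_map_equiv, Equiv.mulRight_symm_apply]
  rw [inv_tau hρρ hττ, hττ]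
  have e : c₀ + (0 - c₀) - a = -a := by abel
  rw [e]
  constructor
  · intro h
    exact ⟨-a, h, neg_neg a⟩
  · rintro ⟨b, hb, rfl⟩
    rwa [neg_neg]

/-- `χ`-sums of the parts of `X·τ0`: `(γ χ(X₁), χ(X₀))` with `γ = χ(c₀)`. [folklore] -/
theorem partSum_mulRight_tau (hρρ : ∀ a b, ρ a * ρ b = ρ (a + b)) (hρτ : ∀ a b, ρ a * τ b = τ (b - a))
    (hττ : ∀ a b, τ a * τ b = ρ (c₀ + b - a)) (hmul : ∀ a b, χ (a + b) = χ a * χ b)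
    (hval : ∀ a, χ a = 1 ∨ χ a = -1) (X : Finset G) :
    (∑ a ∈ univ.filter (fun a : A => ρ a ∈ X.map (Equiv.mulRight (τ 0)).toEmbedding), χ a) = χ c₀ * (∑ a ∈ univ.filter (fun a : A => τ a ∈ X), χ a) ∧
      (∑ a ∈ univ.filter (fun a : A => τ a ∈ X.map (Equiv.mulRight (τ 0)).toEmbedding), χ a) = (∑ a ∈ univ.filter (fun a : A => ρ a ∈ X), χ a) := by
  rw [rho_part_mulRight_tau hρρ hρτ hττ, tau_part_mulRight_tau hρρ hττ, realChar_image_neg_sub hmul hval,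
    realChar_image_neg hmul hval]
  exact ⟨rfl, rfl⟩

/-- **Real-character parity of law-attaining cube triples.**  Dihedral-like `G` over `A` (any `c₀`); a TPP triple
with cube part sizes (`s₀ = s₁`, `t₀ = t₁`, `u₀ = u₁`) attaining `3|S||T||U| + 8 = 8|A|`; `χ : A → {±1}`
multiplicative with `∑_A χ = 0` (a non-trivial real character).  Then the `χ`-sum of every one of the six coset parts is
`1` or `−1`. [folklore] -/
theorem parts_sgnSum_of_law_cube
    (hρρ : ∀ a b, ρ a * ρ b = ρ (a + b)) (hρτ : ∀ a b, ρ a * τ b = τ (b - a))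
    (hτρ : ∀ a b, τ a * ρ b = τ (a + b)) (hττ : ∀ a b, τ a * τ b = ρ (c₀ + b - a))
    (hρ : Function.Injective ρ) (hτ : Function.Injective τ) (hne : ∀ a b, ρ a ≠ τ b)
    (hsurj : ∀ g, (∃ a, ρ a = g) ∨ (∃ a, τ a = g)) (h : TripleProductProperty S T U)
    (hS : (univ.filter fun a : A => ρ a ∈ S).card = (univ.filter fun a : A => τ a ∈ S).card)
    (hT : (univ.filter fun a : A => ρ a ∈ T).card = (univ.filter fun a : A => τ a ∈ T).card)
    (hU : (univ.filter fun a : A => ρ a ∈ U).card = (univ.filter fun a : A => τ a ∈ U).card)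
    (hV : 3 * (S.card * T.card * U.card) + 8 = 8 * Fintype.card A) (hmul : ∀ a b, χ (a + b) = χ a * χ b) (hval : ∀ a, χ a = 1 ∨ χ a = -1) (hsum : ∑ a, χ a = 0) :
    ((∑ a ∈ univ.filter (fun a : A => ρ a ∈ S), χ a) = 1 ∨ (∑ a ∈ univ.filter (fun a : A => ρ a ∈ S), χ a) = -1) ∧ ((∑ a ∈ univ.filter (fun a : A => τ a ∈ S), χ a) = 1 ∨ (∑ a ∈ univ.filter (fun a : A => τ a ∈ S), χ a) = -1) ∧
    ((∑ a ∈ univ.filter (fun a : A => ρ a ∈ T), χ a) = 1 ∨ (∑ a ∈ univ.filter (fun a : A => ρ a ∈ T), χ a) = -1) ∧ ((∑ a ∈ univ.filter (fun a : A => τ a ∈ T), χ a) = 1 ∨ (∑ a ∈ univ.filter (fun a : A => τ a ∈ T), χ a) = -1) ∧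
    ((∑ a ∈ univ.filter (fun a : A => ρ a ∈ U), χ a) = 1 ∨ (∑ a ∈ univ.filter (fun a : A => ρ a ∈ U), χ a) = -1) ∧ ((∑ a ∈ univ.filter (fun a : A => τ a ∈ U), χ a) = 1 ∨ (∑ a ∈ univ.filter (fun a : A => τ a ∈ U), χ a) = -1) := by
  -- numerics: `|A| = 3 s₀ t₀ u₀ + 1`
  set s₀ := (univ.filter fun a : A => ρ a ∈ S).card with hs₀
  set t₀ := (univ.filter fun a : A => ρ a ∈ T).card with ht₀
  set u₀ := (univ.filter fun a : A => ρ a ∈ U).card with hu₀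
  have cS := card_eq_parts' hρ hτ hne hsurj S
  have cT := card_eq_parts' hρ hτ hne hsurj T
  have cU := card_eq_parts' hρ hτ hne hsurj U
  have hprod : S.card * T.card * U.card = 8 * (s₀ * t₀ * u₀) := by
    rw [cS, cT, cU, ← hS, ← hT, ← hU]; ring
  rw [hprod] at hV
  have hN : s₀ * t₀ * u₀ + s₀ * t₀ * u₀ + s₀ * t₀ * u₀ + 1 = Fintype.card A := by omega
  -- the translated triples
  have er : (Equiv.mulRight (1 : G)).toEmbedding = Function.Embedding.refl G := by ext x; simp
  have hS' := h.map_mulRight (τ 0) 1 1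
  have hT' := h.map_mulRight 1 (τ 0) 1
  have hU' := h.map_mulRight 1 1 (τ 0)
  simp only [er, Finset.map_refl] at hS' hT' hU'
  have cρ := card_rho_part_mulRight_tau hρρ hρτ hττ (A := A)
  have cτ := card_tau_part_mulRight_tau hρρ hττ (A := A)
  obtain ⟨pSρ, pSτ⟩ := partSum_mulRight_tau hρρ hρτ hττ hmul hval S
  obtain ⟨pTρ, pTτ⟩ := partSum_mulRight_tau hρρ hρτ hττ hmul hval T
  obtain ⟨pUρ, pUτ⟩ := partSum_mulRight_tau hρρ hρτ hττ hmul hval U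
  -- the eight vertex identities
  have E1 := vertex000_sgnSum hρρ hρτ hτρ hττ hρ hτ hne h hmul hval hsum (by rw [← hS, ← hT, ← hU]; exact hN)
  have E2 := vertex111_sgnSum hρρ hρτ hτρ hττ hρ hτ hne h hmul hval hsum (by rw [← hS, ← hT, ← hU]; exact hN)
  have E3 := vertex000_sgnSum hρρ hρτ hτρ hττ hρ hτ hne hS' hmul hval hsum
    (by rw [cρ, cτ, ← hS, ← hT, ← hU]; exact hN)
  have E4 := vertex111_sgnSum hρρ hρτ hτρ hττ hρ hτ hne hS' hmul hval hsum
    (by rw [cρ, cτ, ← hS, ← hT, ← hU]; exact hN)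
  have E5 := vertex000_sgnSum hρρ hρτ hτρ hττ hρ hτ hne hT' hmul hval hsum
    (by rw [cρ, cτ, ← hS, ← hT, ← hU]; exact hN)
  have E6 := vertex111_sgnSum hρρ hρτ hτρ hττ hρ hτ hne hT' hmul hval hsum
    (by rw [cρ, cτ, ← hS, ← hT, ← hU]; exact hN)
  have E7 := vertex000_sgnSum hρρ hρτ hτρ hττ hρ hτ hne hU' hmul hval hsum
    (by rw [cρ, cτ, ← hS, ← hT, ← hU]; exact hN)
  have E8 := vertex111_sgnSum hρρ hρτ hτρ hττ hρ hτ hne hU' hmul hval hsum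
    (by rw [cρ, cτ, ← hS, ← hT, ← hU]; exact hN)
  rw [pSρ, pSτ] at E3 E4
  rw [pTρ, pTτ] at E5 E6
  rw [pUρ, pUτ] at E7 E8
  set σ₀ := (∑ a ∈ univ.filter (fun a : A => ρ a ∈ S), χ a)
  set σ₁ := (∑ a ∈ univ.filter (fun a : A => τ a ∈ S), χ a)
  set π₀ := (∑ a ∈ univ.filter (fun a : A => ρ a ∈ T), χ a)
  set π₁ := (∑ a ∈ univ.filter (fun a : A => τ a ∈ T), χ a)
  set ξ₀ := (∑ a ∈ univ.filter (fun a : A => ρ a ∈ U), χ a)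
  set ξ₁ := (∑ a ∈ univ.filter (fun a : A => τ a ∈ U), χ a)
  set γ := χ c₀
  have hγ : γ = 1 ∨ γ = -1 := hval c₀
  -- `3 B₀₀₀ + 2γ ε₂ = ε₃ + ε₅ + ε₇` and `3 γ B₁₁₁ + 2 ε₁ = ε₄ + ε₆ + ε₈`
  obtain ⟨ε₁, hε₁, hE1⟩ : ∃ ε : ℤ, (ε = 1 ∨ ε = -1) ∧ σ₁ * π₀ * ξ₀ + σ₀ * π₁ * ξ₀ + σ₀ * π₀ * ξ₁ = ε :=
    ⟨_, E1, rfl⟩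
  obtain ⟨ε₂, hε₂, hE2⟩ : ∃ ε : ℤ, (ε = 1 ∨ ε = -1) ∧ σ₀ * π₁ * ξ₁ + σ₁ * π₀ * ξ₁ + σ₁ * π₁ * ξ₀ = ε :=
    ⟨_, E2, rfl⟩
  obtain ⟨ε₃, hε₃, hE3⟩ : ∃ ε : ℤ, (ε = 1 ∨ ε = -1) ∧
      σ₀ * π₀ * ξ₀ + γ * σ₁ * π₁ * ξ₀ + γ * σ₁ * π₀ * ξ₁ = ε := ⟨_, E3, by ring⟩
  obtain ⟨ε₄, hε₄, hE4⟩ : ∃ ε : ℤ, (ε = 1 ∨ ε = -1) ∧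
      γ * σ₁ * π₁ * ξ₁ + σ₀ * π₀ * ξ₁ + σ₀ * π₁ * ξ₀ = ε := ⟨_, E4, by ring⟩
  obtain ⟨ε₅, hε₅, hE5⟩ : ∃ ε : ℤ, (ε = 1 ∨ ε = -1) ∧
      σ₁ * (γ * π₁) * ξ₀ + σ₀ * π₀ * ξ₀ + σ₀ * (γ * π₁) * ξ₁ = ε := ⟨_, E5, by ring⟩
  obtain ⟨ε₆, hε₆, hE6⟩ : ∃ ε : ℤ, (ε = 1 ∨ ε = -1) ∧
      σ₀ * π₀ * ξ₁ + σ₁ * (γ * π₁) * ξ₁ + σ₁ * π₀ * ξ₀ = ε := ⟨_, E6, by ring⟩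
  obtain ⟨ε₇, hε₇, hE7⟩ : ∃ ε : ℤ, (ε = 1 ∨ ε = -1) ∧
      σ₁ * π₀ * (γ * ξ₁) + σ₀ * π₁ * (γ * ξ₁) + σ₀ * π₀ * ξ₀ = ε := ⟨_, E7, by ring⟩
  obtain ⟨ε₈, hε₈, hE8⟩ : ∃ ε : ℤ, (ε = 1 ∨ ε = -1) ∧
      σ₀ * π₁ * ξ₀ + σ₁ * π₀ * ξ₀ + σ₁ * π₁ * (γ * ξ₁) = ε := ⟨_, E8, by ring⟩
  have hB0 : 3 * (σ₀ * π₀ * ξ₀) + 2 * γ * ε₂ = ε₃ + ε₅ + ε₇ := by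
    rw [← hE2, ← hE3, ← hE5, ← hE7]; ring
  have hγ2 : γ * γ = 1 := by rcases hγ with h | h <;> rw [h] <;> norm_num
  have hB1 : 3 * (γ * (σ₁ * π₁ * ξ₁)) + 2 * 1 * ε₁ = ε₄ + ε₆ + ε₈ := by
    rw [← hE1, ← hE4, ← hE6, ← hE8]; ring
  have h0 := pm_one_of_three_mul hγ hε₂ hε₃ hε₅ hε₇ hB0
  have h1' := pm_one_of_three_mul (Or.inl rfl) hε₁ hε₄ hε₆ hε₈ hB1
  have h1 : σ₁ * π₁ * ξ₁ = 1 ∨ σ₁ * π₁ * ξ₁ = -1 := by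
    rcases hγ with h | h <;> rw [h] at h1' <;> omega
  obtain ⟨a0, b0, c0'⟩ := pm_one_of_mul₃ h0
  obtain ⟨a1, b1, c1⟩ := pm_one_of_mul₃ h1
  exact ⟨a0, a1, b0, b1, c0', c1⟩

end DihedralLike

end Summit.MatrixMultiplication.OmegaCensus
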